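import Summits.HubbardSuperconductivity.HubbardSuperconductivity.Theorems.BalabanIRBirComplexStableXYRConvexityRadius
import HarnessLib

/-!
# Crux `BirComplexStableXYR` (stmt-HubbardSuperconductivity-14845): log-concavity of the modulus
# weight `|e^{-A}|` on the small-oscillation core

Support file (prover seat 0, route BalabanIR), consequences of the convexity radius
(`…BirComplexStableXYRConvexityRadius`) for the restated engine `…Theses.BalabanIR.BirComplexStableXYR`:

* `cvxr_hasDerivAt_genF_line`, `cvxr_hasDerivAt_dgenF_line` (+ real parts) — the form
  `H_c(φ)v = -Σ_n c_n (n·v)² e^{i n·φ}` IS the second derivative of `t ↦ F(φ + tv)`;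
* `cvxr_convexOn_re_genF` — a non-negative real Hessian on the (convex, `cvxr_convex_oscSet`)
  small-oscillation set `{φ | ∀ w w', |φ_w - φ_w'| ≤ δ}` makes `Re F` convex there (reduction to lines,
  Mathlib's `convexOn_of_deriv2_nonneg'`);
* `cvxr_convexOn_re_action` — hence, for `K ≥ 0`, `Re A = K Σ_s Re F(θ ∘ sh s)` is convex on the CORE
  `{θ | ∀ s w w', |θ(sh s w) - θ(sh s w')| ≤ δ}` of the space-time torus (`cvxr_convex_core`), i.e. the
  modulus `|e^{-A}| = e^{-Re A}` of the complex Boltzmann weight is LOG-CONCAVE on the core;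
* `convexityRadius_convexOn`, `convexityRadius_core` — packaged with the `K`-independent radius
  `δ₀(B, c₀)` of `convexityRadius`: for every admissible table ((U1), (N), (A) `≤ B`, (C) with `c₀`),
  every `K ≥ 0` and every torus `(ℤ/L)² × ℤ/M`.

This is the lever of idea card `Cruxes/BirComplexStableXYR/Ideas/log-concave-core-bounded-phase.md`
("pay for every large field and every vortex with `|e^{-A}|` alone — Brascamp–Lieb inside the
`K`-independent convexity radius of the class"); the uniform modulus `c₀/4 · K` of convexity
transversal to constants is `convexityRadius` itself.  The exact smoothed-box lift, the defect
expansion and Brascamp–Lieb are NOT here. [folklore]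
-/

noncomputable section

namespace Summit.HubbardSuperconductivity.HubbardSuperconductivity.Theorems

open scoped BigOperators
open Summit.HubbardSuperconductivity.BirComplexStableXYNegative

section LogConcaveCore

variable {r : ℕ}

/-! ### The Hessian form is the second derivative along lines -/

/-- First derivative of `F` along the line `s ↦ φ + s v`:
`d/ds F(φ + sv) = Σ_n c_n (n·v) i e^{i n·(φ + sv)}`. [folklore] -/
theorem cvxr_hasDerivAt_genF_line (c : Table r) (φ v : W r → ℝ) (t : ℝ) :
    HasDerivAt (fun s : ℝ => genF c (fun w => φ w + s * v w))
      (c.sum (fun n a => a * ((∑ w, (n w : ℝ) * v w : ℝ) : ℂ) * Complex.I *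
        Complex.exp (Complex.I * ((∑ w, (n w : ℝ) * (φ w + t * v w) : ℝ) : ℂ)))) t := by
  classical
  have hfun : (fun s : ℝ => genF c (fun w => φ w + s * v w)) = fun s : ℝ =>
      ∑ n ∈ c.support, c n * Complex.exp (Complex.I *
        (((∑ w, (n w : ℝ) * φ w) + s * (∑ w, (n w : ℝ) * v w) : ℝ) : ℂ)) := by
    funext s
    unfold genF Finsupp.sum
    refine Finset.sum_congr rfl fun n _ => ?_
    show c n * Complex.exp (Complex.I * ((∑ w, (n w : ℝ) * (φ w + s * v w) : ℝ) : ℂ)) = _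
    rw [cvxr_frq_add, cvxr_frq_smul]
  rw [hfun]
  unfold Finsupp.sum
  have hterm : ∀ n ∈ c.support, HasDerivAt (fun s : ℝ => c n * Complex.exp (Complex.I *
      (((∑ w, (n w : ℝ) * φ w) + s * (∑ w, (n w : ℝ) * v w) : ℝ) : ℂ)))
      (c n * ((∑ w, (n w : ℝ) * v w : ℝ) : ℂ) * Complex.I *
        Complex.exp (Complex.I * ((∑ w, (n w : ℝ) * (φ w + t * v w) : ℝ) : ℂ))) t := by
    intro n _
    set P : ℝ := ∑ w, (n w : ℝ) * φ w with hP
    set A : ℝ := ∑ w, (n w : ℝ) * v w with hA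
    have hlin : HasDerivAt (fun s : ℝ => P + s * A) A t := by
      simpa using ((hasDerivAt_id t).mul_const A).const_add P
    have hC : HasDerivAt (fun s : ℝ => Complex.I * ((P + s * A : ℝ) : ℂ)) (Complex.I * (A : ℂ)) t :=
      (hlin.ofReal_comp).const_mul Complex.I
    have hE := (hC.cexp).const_mul (c n)
    have hPA : (∑ w, (n w : ℝ) * (φ w + t * v w)) = P + t * A := by
      rw [hP, hA, cvxr_frq_add, cvxr_frq_smul]
    rw [hPA]
    exact hE.congr_deriv (by ring)
  exact HasDerivAt.fun_sum hterm

/-- Second derivative of `F` along the line `s ↦ φ + s v`: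
`d/ds [Σ_n c_n (n·v) i e^{i n·(φ + sv)}] = -Σ_n c_n (n·v)² e^{i n·(φ + sv)} = H_c(φ + sv)v`. [folklore] -/
theorem cvxr_hasDerivAt_dgenF_line (c : Table r) (φ v : W r → ℝ) (t : ℝ) :
    HasDerivAt (fun s : ℝ => c.sum (fun n a => a * ((∑ w, (n w : ℝ) * v w : ℝ) : ℂ) * Complex.I *
        Complex.exp (Complex.I * ((∑ w, (n w : ℝ) * (φ w + s * v w) : ℝ) : ℂ))))
      (-c.sum (fun n a => a * (((∑ w, (n w : ℝ) * v w) ^ 2 : ℝ) : ℂ) *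
        Complex.exp (Complex.I * ((∑ w, (n w : ℝ) * (φ w + t * v w) : ℝ) : ℂ)))) t := by
  classical
  unfold Finsupp.sum
  rw [← Finset.sum_neg_distrib]
  have hterm : ∀ n ∈ c.support, HasDerivAt (fun s : ℝ => c n * ((∑ w, (n w : ℝ) * v w : ℝ) : ℂ) *
      Complex.I * Complex.exp (Complex.I * ((∑ w, (n w : ℝ) * (φ w + s * v w) : ℝ) : ℂ)))
      (-(c n * (((∑ w, (n w : ℝ) * v w) ^ 2 : ℝ) : ℂ) *
        Complex.exp (Complex.I * ((∑ w, (n w : ℝ) * (φ w + t * v w) : ℝ) : ℂ)))) t := by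
    intro n _
    set P : ℝ := ∑ w, (n w : ℝ) * φ w with hP
    set A : ℝ := ∑ w, (n w : ℝ) * v w with hA
    have hfun : (fun s : ℝ => c n * (A : ℂ) * Complex.I *
        Complex.exp (Complex.I * ((∑ w, (n w : ℝ) * (φ w + s * v w) : ℝ) : ℂ))) =
        fun s : ℝ => c n * (A : ℂ) * Complex.I * Complex.exp (Complex.I * ((P + s * A : ℝ) : ℂ)) := by
      funext s
      rw [hP, hA, cvxr_frq_add, cvxr_frq_smul]
    rw [hfun]
    have hlin : HasDerivAt (fun s : ℝ => P + s * A) A t := by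
      simpa using ((hasDerivAt_id t).mul_const A).const_add P
    have hC : HasDerivAt (fun s : ℝ => Complex.I * ((P + s * A : ℝ) : ℂ)) (Complex.I * (A : ℂ)) t :=
      (hlin.ofReal_comp).const_mul Complex.I
    have hE := (hC.cexp).const_mul (c n * (A : ℂ) * Complex.I)
    have hPA : (∑ w, (n w : ℝ) * (φ w + t * v w)) = P + t * A := by
      rw [hP, hA, cvxr_frq_add, cvxr_frq_smul]
    rw [hPA]
    set E := Complex.exp (Complex.I * ((P + t * A : ℝ) : ℂ)) with hEdef
    have e1 : c n * (A : ℂ) * Complex.I * (E * (Complex.I * (A : ℂ))) =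
        c n * (A : ℂ) ^ 2 * E * (Complex.I * Complex.I) := by ring
    refine hE.congr_deriv ?_
    rw [e1, Complex.I_mul_I]
    push_cast
    ring
  exact HasDerivAt.fun_sum hterm

/-- Real part of the first derivative along a line. [folklore] -/
theorem cvxr_hasDerivAt_re_genF_line (c : Table r) (φ v : W r → ℝ) (t : ℝ) :
    HasDerivAt (fun s : ℝ => (genF c (fun w => φ w + s * v w)).re)
      (c.sum (fun n a => a * ((∑ w, (n w : ℝ) * v w : ℝ) : ℂ) * Complex.I *
        Complex.exp (Complex.I * ((∑ w, (n w : ℝ) * (φ w + t * v w) : ℝ) : ℂ)))).re t := by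
  have h := cvxr_hasDerivAt_genF_line c φ v t
  have h2 := Complex.reCLM.hasFDerivAt.comp_hasDerivAt t h
  simpa only [Function.comp_def, Complex.reCLM_apply] using h2

/-- Real part of the second derivative along a line. [folklore] -/
theorem cvxr_hasDerivAt_re_dgenF_line (c : Table r) (φ v : W r → ℝ) (t : ℝ) :
    HasDerivAt (fun s : ℝ => (c.sum (fun n a => a * ((∑ w, (n w : ℝ) * v w : ℝ) : ℂ) * Complex.I *
        Complex.exp (Complex.I * ((∑ w, (n w : ℝ) * (φ w + s * v w) : ℝ) : ℂ)))).re)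
      (-c.sum (fun n a => a * (((∑ w, (n w : ℝ) * v w) ^ 2 : ℝ) : ℂ) *
        Complex.exp (Complex.I * ((∑ w, (n w : ℝ) * (φ w + t * v w) : ℝ) : ℂ)))).re t := by
  have h := cvxr_hasDerivAt_dgenF_line c φ v t
  have h2 := Complex.reCLM.hasFDerivAt.comp_hasDerivAt t h
  simpa only [Function.comp_def, Complex.reCLM_apply] using h2

/-- The small-oscillation set `{φ | ∀ w w', |φ_w - φ_w'| ≤ δ}` is convex. [folklore] -/
theorem cvxr_convex_oscSet (δ : ℝ) :
    Convex ℝ {φ : W r → ℝ | ∀ w w', |φ w - φ w'| ≤ δ} := by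
  intro φ hφ ψ hψ a b ha hb hab w w'
  simp only [Set.mem_setOf_eq] at hφ hψ
  have e : (a • φ + b • ψ) w - (a • φ + b • ψ) w' = a * (φ w - φ w') + b * (ψ w - ψ w') := by
    simp only [Pi.add_apply, Pi.smul_apply, smul_eq_mul]; ring
  rw [e]
  calc |a * (φ w - φ w') + b * (ψ w - ψ w')| ≤ |a * (φ w - φ w')| + |b * (ψ w - ψ w')| :=
        abs_add_le _ _
    _ = a * |φ w - φ w'| + b * |ψ w - ψ w'| := by
        rw [abs_mul, abs_mul, abs_of_nonneg ha, abs_of_nonneg hb]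
    _ ≤ a * δ + b * δ := add_le_add (mul_le_mul_of_nonneg_left (hφ w w') ha)
        (mul_le_mul_of_nonneg_left (hψ w w') hb)
    _ = δ := by rw [← add_mul, hab, one_mul]

/-- **Convexity of `Re F` on the small-oscillation set from a non-negative real Hessian.**  If the
real Hessian form `Re H_c(φ)v` is `≥ 0` at every `φ` of oscillation `≤ δ` and every direction `v`,
then `Re F` is convex on `{φ | ∀ w w', |φ_w - φ_w'| ≤ δ}` (reduction to lines and Mathlib's
`convexOn_of_deriv2_nonneg'`). [folklore] -/
theorem cvxr_convexOn_re_genF (c : Table r) (δ : ℝ)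
    (hH : ∀ φ : W r → ℝ, (∀ w w', |φ w - φ w'| ≤ δ) → ∀ v : W r → ℝ,
      0 ≤ (-c.sum (fun n a => a * (((∑ w, (n w : ℝ) * v w) ^ 2 : ℝ) : ℂ) *
        Complex.exp (Complex.I * ((∑ w, (n w : ℝ) * φ w : ℝ) : ℂ)))).re) :
    ConvexOn ℝ {φ : W r → ℝ | ∀ w w', |φ w - φ w'| ≤ δ} (fun φ => (genF c φ).re) := by
  refine ⟨cvxr_convex_oscSet δ, ?_⟩
  intro φ hφ ψ hψ a b ha hb hab
  -- the line through `φ` in direction `ψ - φ`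
  set v : W r → ℝ := fun w => ψ w - φ w with hv
  set g : ℝ → ℝ := fun s => (genF c (fun w => φ w + s * v w)).re with hg
  set g1 : ℝ → ℝ := fun s => (c.sum (fun n a => a * ((∑ w, (n w : ℝ) * v w : ℝ) : ℂ) * Complex.I *
      Complex.exp (Complex.I * ((∑ w, (n w : ℝ) * (φ w + s * v w) : ℝ) : ℂ)))).re with hg1
  set g2 : ℝ → ℝ := fun s => (-c.sum (fun n a => a * (((∑ w, (n w : ℝ) * v w) ^ 2 : ℝ) : ℂ) *
      Complex.exp (Complex.I * ((∑ w, (n w : ℝ) * (φ w + s * v w) : ℝ) : ℂ)))).re with hg2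
  have hd1 : ∀ s, HasDerivAt g (g1 s) s := fun s => cvxr_hasDerivAt_re_genF_line c φ v s
  have hd2 : ∀ s, HasDerivAt g1 (g2 s) s := fun s => cvxr_hasDerivAt_re_dgenF_line c φ v s
  have hderiv1 : deriv g = g1 := funext fun s => (hd1 s).deriv
  have hderiv2 : deriv g1 = g2 := funext fun s => (hd2 s).deriv
  -- points of the segment stay in the small-oscillation set
  have hmem : ∀ s ∈ Set.Icc (0:ℝ) 1, ∀ w w', |(φ w + s * v w) - (φ w' + s * v w')| ≤ δ := by
    intro s hs w w'
    have hcomb := cvxr_convex_oscSet δ hφ hψ (sub_nonneg.2 hs.2) hs.1 (by ring)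
    have e : ∀ w, ((1 - s) • φ + s • ψ) w = φ w + s * v w := by
      intro w; simp only [Pi.add_apply, Pi.smul_apply, smul_eq_mul, hv]; ring
    have := hcomb w w'
    rwa [e w, e w'] at this
  have hconv : ConvexOn ℝ (Set.Icc (0:ℝ) 1) g := by
    refine convexOn_of_deriv2_nonneg' (convex_Icc 0 1)
      (fun s _ => (hd1 s).differentiableAt.differentiableWithinAt) ?_ ?_
    · rw [hderiv1]
      exact fun s _ => (hd2 s).differentiableAt.differentiableWithinAt
    · intro s hs
      show 0 ≤ deriv (deriv g) s
      rw [hderiv1, hderiv2, hg2]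
      exact hH (fun w => φ w + s * v w) (hmem s hs) v
  have h0 : (0:ℝ) ∈ Set.Icc (0:ℝ) 1 := ⟨le_rfl, zero_le_one⟩
  have h1 : (1:ℝ) ∈ Set.Icc (0:ℝ) 1 := ⟨zero_le_one, le_rfl⟩
  have key := hconv.2 h0 h1 ha hb hab
  simp only [smul_eq_mul, mul_zero, zero_add, mul_one] at key
  -- identify the three values of `g`
  have eφ : g 0 = (genF c φ).re := by
    simp only [hg, zero_mul, add_zero]
  have eψ : g 1 = (genF c ψ).re := by
    simp only [hg, hv, one_mul, add_sub_cancel]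
  have eab : g b = (genF c (a • φ + b • ψ)).re := by
    simp only [hg, hv]
    congr 3
    funext w
    simp only [Pi.add_apply, Pi.smul_apply, smul_eq_mul]
    have : a = 1 - b := by linarith
    rw [this]; ring
  rw [eφ, eψ, eab] at key
  simpa [smul_eq_mul] using key

/-- **Convexity radius ⇒ convexity of `Re F`.**  With `δ₀ = δ₀(B, c₀) > 0` of `convexityRadius`:
for every admissible table ((U1), (N), (A) `≤ B`, (C) with `c₀`), `Re F` is convex on the
small-oscillation set `{φ | ∀ w w', |φ_w - φ_w'| ≤ δ₀}`. [folklore] -/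
theorem convexityRadius_convexOn (r : ℕ) (B c₀ : ℝ) (hc₀ : 0 < c₀) :
    ∃ δ₀ : ℝ, 0 < δ₀ ∧ ∀ c : Table r,
      (∀ n ∈ c.support, ∑ w, n w = 0) → c.sum (fun _ a => a) = 0 → normA c ≤ B →
      (∀ φ : W r → ℝ, c₀ * ∑ w, ∑ w', (1 - Real.cos (φ w - φ w')) ≤ (genF c φ).re) →
      ConvexOn ℝ {φ : W r → ℝ | ∀ w w', |φ w - φ w'| ≤ δ₀} (fun φ => (genF c φ).re) := by
  obtain ⟨δ₀, hδ₀, h⟩ := convexityRadius r B c₀ hc₀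
  refine ⟨δ₀, hδ₀, fun c hU1 hN hA hC => cvxr_convexOn_re_genF c δ₀ fun φ hφ v => ?_⟩
  have h1 := (h c hU1 hN hA hC φ hφ v).1
  have hD : 0 ≤ ∑ w, ∑ w', (v w - v w') ^ 2 :=
    Finset.sum_nonneg fun _ _ => Finset.sum_nonneg fun _ _ => sq_nonneg _
  have : 0 ≤ c₀ / 4 * ∑ w, ∑ w', (v w - v w') ^ 2 := by positivity
  linarith

/-- The CORE `{θ | every window of θ oscillates by at most δ}` of the space-time torus is convex. [folklore] -/
theorem cvxr_convex_core (L M : ℕ) (δ : ℝ) :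
    Convex ℝ {θ : Λ L M → ℝ | ∀ (s : Λ L M) (w w' : W r), |θ (sh L M s w) - θ (sh L M s w')| ≤ δ} := by
  intro θ hθ η hη a b ha hb hab s w w'
  simp only [Set.mem_setOf_eq] at hθ hη
  have e : (a • θ + b • η) (sh L M s w) - (a • θ + b • η) (sh L M s w') =
      a * (θ (sh L M s w) - θ (sh L M s w')) + b * (η (sh L M s w) - η (sh L M s w')) := by
    simp only [Pi.add_apply, Pi.smul_apply, smul_eq_mul]; ring
  rw [e]
  calc |a * (θ (sh L M s w) - θ (sh L M s w')) + b * (η (sh L M s w) - η (sh L M s w'))|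
      ≤ |a * (θ (sh L M s w) - θ (sh L M s w'))| + |b * (η (sh L M s w) - η (sh L M s w'))| :=
        abs_add_le _ _
    _ = a * |θ (sh L M s w) - θ (sh L M s w')| + b * |η (sh L M s w) - η (sh L M s w')| := by
        rw [abs_mul, abs_mul, abs_of_nonneg ha, abs_of_nonneg hb]
    _ ≤ a * δ + b * δ := add_le_add (mul_le_mul_of_nonneg_left (hθ s w w') ha)
        (mul_le_mul_of_nonneg_left (hη s w w') hb)
    _ = δ := by rw [← add_mul, hab, one_mul]

/-- **Log-concavity of the modulus weight on the core.**  If `Re F` is convex on the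
small-oscillation set of the window, then for `K ≥ 0` the real part of the action
`A(θ) = K Σ_s F(θ ∘ sh s)` is convex on the core `{θ | ∀ s w w', |θ(sh s w) - θ(sh s w')| ≤ δ}`
— i.e. `|e^{-A}| = e^{-Re A}` is log-concave there (the lever of idea card
`log-concave-core-bounded-phase`). [folklore] -/
theorem cvxr_convexOn_re_action (c : Table r) {K : ℝ} (hK : 0 ≤ K) (L M : ℕ) [NeZero L] [NeZero M]
    (δ : ℝ) (hconv : ConvexOn ℝ {φ : W r → ℝ | ∀ w w', |φ w - φ w'| ≤ δ} (fun φ => (genF c φ).re)) :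
    ConvexOn ℝ {θ : Λ L M → ℝ | ∀ (s : Λ L M) (w w' : W r), |θ (sh L M s w) - θ (sh L M s w')| ≤ δ}
      (fun θ => (action K c L M θ).re) := by
  refine ⟨cvxr_convex_core L M δ, ?_⟩
  intro θ hθ η hη a b ha hb hab
  simp only [Set.mem_setOf_eq] at hθ hη
  have hre : ∀ ξ : Λ L M → ℝ, (action K c L M ξ).re =
      K * ∑ s, (genF c (fun w => ξ (sh L M s w))).re := by
    intro ξ
    unfold action
    rw [Complex.re_ofReal_mul, Complex.re_sum]
  -- pointwise convexity of each window term
  have hpt : ∀ s : Λ L M, (genF c (fun w => (a • θ + b • η) (sh L M s w))).re ≤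
      a * (genF c (fun w => θ (sh L M s w))).re + b * (genF c (fun w => η (sh L M s w))).re := by
    intro s
    have hθs : (fun w => θ (sh L M s w)) ∈ {φ : W r → ℝ | ∀ w w', |φ w - φ w'| ≤ δ} :=
      fun w w' => hθ s w w'
    have hηs : (fun w => η (sh L M s w)) ∈ {φ : W r → ℝ | ∀ w w', |φ w - φ w'| ≤ δ} :=
      fun w w' => hη s w w'
    have key := hconv.2 hθs hηs ha hb hab
    have e : (a • (fun (w : W r) => θ (sh L M s w)) + b • (fun (w : W r) => η (sh L M s w))) =
        fun (w : W r) => (a • θ + b • η) (sh L M s w) := by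
      funext w; simp only [Pi.add_apply, Pi.smul_apply, smul_eq_mul]
    rw [e] at key
    simpa only [smul_eq_mul] using key
  simp only [smul_eq_mul]
  rw [hre, hre θ, hre η]
  calc K * ∑ s, (genF c (fun w => (a • θ + b • η) (sh L M s w))).re
      ≤ K * ∑ s, (a * (genF c (fun w => θ (sh L M s w))).re +
          b * (genF c (fun w => η (sh L M s w))).re) :=
        mul_le_mul_of_nonneg_left (Finset.sum_le_sum fun s _ => hpt s) hK
    _ = a * (K * ∑ s, (genF c (fun w => θ (sh L M s w))).re) +
          b * (K * ∑ s, (genF c (fun w => η (sh L M s w))).re) := by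
        rw [Finset.sum_add_distrib, ← Finset.mul_sum, ← Finset.mul_sum]; ring

/-- **The convexity radius of the class, lifted to the torus.**  With `δ₀ = δ₀(B, c₀) > 0` of
`convexityRadius`: for every admissible table, every stiffness `K ≥ 0` and every torus
`(ℤ/L)² × ℤ/M`, `Re A` is convex — `|e^{-A}|` is log-concave — on the core
`{θ | ∀ s w w', |θ(sh s w) - θ(sh s w')| ≤ δ₀}`, a `K`-independent neighbourhood of the constants
(modulo `2π`-lifts, which are the business of the line's lift). [folklore] -/
theorem convexityRadius_core (r : ℕ) (B c₀ : ℝ) (hc₀ : 0 < c₀) :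
    ∃ δ₀ : ℝ, 0 < δ₀ ∧ ∀ c : Table r,
      (∀ n ∈ c.support, ∑ w, n w = 0) → c.sum (fun _ a => a) = 0 → normA c ≤ B →
      (∀ φ : W r → ℝ, c₀ * ∑ w, ∑ w', (1 - Real.cos (φ w - φ w')) ≤ (genF c φ).re) →
      ∀ (K : ℝ), 0 ≤ K → ∀ (L M : ℕ) [NeZero L] [NeZero M],
        ConvexOn ℝ {θ : Λ L M → ℝ | ∀ (s : Λ L M) (w w' : W r), |θ (sh L M s w) - θ (sh L M s w')| ≤ δ₀}
          (fun θ => (action K c L M θ).re) := by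
  obtain ⟨δ₀, hδ₀, h⟩ := convexityRadius_convexOn r B c₀ hc₀
  exact ⟨δ₀, hδ₀, fun c hU1 hN hA hC K hK L M _ _ =>
    cvxr_convexOn_re_action c hK L M δ₀ (h c hU1 hN hA hC)⟩

end LogConcaveCore

end Summit.HubbardSuperconductivity.HubbardSuperconductivity.Theorems
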